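import Mathlib
import HarnessLib
import HarnessLib.Audit
import Summits.HubbardSuperconductivity.Statement
import Summits.HubbardSuperconductivity.HubbardSuperconductivity.Theorems.BalabanIRAssemblyFrame
import Summits.HubbardSuperconductivity.HubbardSuperconductivity.Theorems.BalabanIRBirBdGPhaseCoercivityLyapunovFinal
import Summits.HubbardSuperconductivity.HubbardSuperconductivity.Theorems.BalabanIRBirRClassEvenNoZeros
import HarnessLib.Audit.Status.Attr

/-!
Route: BalabanIR

Route BalabanIR — realises idea card complex-stable-balaban-ir-engine (positivity-free infrared
engine for the Cooper-pair phase).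
IT SUFFICES TO SHOW X := X_avg ∧ X_every, both typed in Lean over existing declarations
(hubbardTorus, szSector, Matrix.minEnergyOn, QuantumLattice.projMatrix, pairField dWaveFormFactor,
HasDWavePairFieldLROAt):
• X_avg = BirGroundStateAverageLRO (target, rank 0): ∃ δ ∈ (0,1/2), 0 < U₁ < U₂, c > 0 such that for
every U ∈ (U₁,U₂), eventually in even L, the UNIFORM AVERAGE over the ground eigenspace E₀(U,L) of
`hubbardTorus 2 L 1 U` in the sector (N_L = 2⌊(1−δ)L²/2⌋, S^z = 0) has tr(P_{E₀} Δ_d†Δ_d) ≥ c·L⁴·tr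
P_{E₀} — ground-state-AVERAGE d_{x²−y²} pair-field LRO on an open window of weak couplings (one
line: `∃ δ ∈ Set.Ioo 0 (1/2), ∃ U₁ U₂ c, 0<U₁ ∧ U₁<U₂ ∧ 0<c ∧ ∀ U ∈ Set.Ioo U₁ U₂, ∃ L₀, ∀ L ≥ L₀
even, c*L^4*(tr P).re ≤ (tr (P * (Δ_dᴴ * Δ_d))).re` with P = projMatrix of szSector N 0 ⊓
eigenspace(toLin' H)(minEnergyOn H (szSector N 0))).
• X_every = BirEveryGroundState (crux 5): GS-average LRO on an open U-interval ⇒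
`HasDWavePairFieldLROAt U δ` (the summit's matrix: EVERY sector ground-state sequence, even sides)
for SOME U in the interval — Rellich–Kato analytic eigenbranches in U plus Schur.
Lean: BirGroundStateAverageLRO ∧ BirEveryGroundState (= X; the Assembly item
`BirGroundStateAverageLRO ∧ BirEveryGroundState → HubbardSuperconductivity` is PROVED,
Theorems.BalabanIR.assembly_frame_proof). DECIDING THEOREM (rev 8, 2026-08-16 — the engine chain is
now the hypothesis list of `closes`, so that every declared crux lies in its item cone): `closes
(h2R : BirComplexStableXYR) (h3 : BirBdGPhaseCoercivity) (h4R : BirGappedPhaseReductionR) (hT :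
BirEveryGroundState) : _root_.HubbardSuperconductivity` — pure logic: hX : BirGroundStateAverageLRO
:= h4R h2R h3 (crux 4R is typed BirComplexStableXYR → BirBdGPhaseCoercivity →
BirGroundStateAverageLRO), then δ, U₁ < U₂, c from hX; X_every on (U₁,U₂) gives a coupling U with
every-ground-state LRO; 0 < U₁ < U (native OK; the rev-3…7 form `closes (hX) (hT)` is the same
argument with hX a hypothesis). X_avg = BirGroundStateAverageLRO stays an item (rank 0; in the cone
through crux 4R's statement) and stays attackable DIRECTLY (line softmin-pair-penalty): a direct
proof makes 4R immediate and, with X_every, proves the summit through the Assembly item regardless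
of cruxes 2R/3.
THE BET is crux 2R — a third rigorous engine for continuous-symmetry order besides reflection
positivity and abelian duality/gauge fixing (and besides Garban–Spencer's ferromagnetic-positivity
reconstruction, arXiv:2109.01617, which fermion-induced complex actions defeat just as they defeat
RP): Balaban's multiscale low-temperature expansion extended to COMPLEX quasi-local actions with
COERCIVE real part that are TIME-REFLECTION HERMITIAN and INVERSION-EVEN. Dictionary (explicit):
pair phase of the Hubbard torus below the gap scale Δ ↦ compact U(1) field θ on the anisotropic
(2+1)D torus (ℤ/L)²×(ℤ/M) (spatial block ξ = v_F/Δ, time step 1/Δ, M = βΔ ≥ L even, M → ∞ at fixed L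
= ground state); stiffness K ~ E_F/Δ ~ exp(+1/(αρ²U²)) — THE SMALLNESS OF THE BCS GAP IS THE
COLDNESS OF THE XY MODEL; GS-average L⁻⁴⟨Δ_d†Δ_d⟩ ↦ Z|ψ_{B1g}|²·(equal-time slice order of θ).
Engine theorem BirComplexStableXYR (crux 2R, Lean): for U(1)-invariant translation-invariant window
actions K·Σ_s F(θ|_{s+W_r}), F a trigonometric polynomial (finite Fourier table c) with (U1) charge
neutrality, (N) F(const) = 0, (A) exp-weighted ℓ¹ Fourier norm ≤ B, (C) Re F ≥ c₀·Σ_{w,w'∈W}(1 −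
cos(θ_w − θ_{w'})), (R) c_{n∘R} = conj c_{−n} (F(θ∘R) = conj F(θ), R = time reflection of the window
— automatic for actions of Hamiltonian origin) and (P) c_{n∘P} = c_n (spatial inversion of the
window — free for inversion-symmetric models), there is K₀(r,B,c₀) with: K ≥ K₀ ⇒ Z ≠ 0 and
Re⟨|L⁻²Σ_x e^{iθ(x,0)}|²⟩ ≥ 1/2 for all even L₀ ≤ L ≤ M (complex weights e^{−KΣF}, product Lebesgue
measure on [0,2π]^Λ). The rev-0 engine BirComplexStableXY (same without (R),(P), all L ≤ M) is
REFUTED IN SUBSTANCE — Beraha–Kahane–Weiss transfer-operator zeros of Z = Tr T^M at M ~ K²L⁴ for an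
admissible table with complex temporal stiffness (refuter 702958a1;
Cruxes/BirComplexStableXY/Disproof.lean §3, `witness_admissible` sorry-free; prover verdict
misstated ×5; Theorems…FixedVolumeUniform isolates the false content as (L,M)-uniformity) — and is
kept only as a superseded support record (its decl is named by Theorems modules); (R) excludes that
witness (`witness_not_timeReflectionHermitian`) and makes Z real (`partZ_conj_of_OS`), positive at
even M for r = 2 (`birEven_partitionFunction_pos`). BirBdGPhaseCoercivity (crux 3, Lean) is the
static, cheaply falsifiable core of the coercivity hypothesis for the d+id Bogoliubov–de Gennes
reference, now an explicit INPUT of the reduction (typed Fock/Hölder dictionary landed: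
fockCoercivity_of_birBdGPhaseCoercivity, FermionWeight); BirGappedPhaseReductionR (crux 4R) carries
the fermionic integration in a fully gapped window and the shared weak-coupling bet; its β → ∞
endgame (thermal sector bound ⇒ X_avg's body) is proved Theses-free
(Theorems.BalabanIRBirGappedPhaseReductionStructural). The rev-0 reduction BirGappedPhaseReduction
:= BirComplexStableXY → BirGroundStateAverageLRO is kept as a superseded support record (glue-shaped
over the refuted engine).
MATERIALISATION RULE (rev 5, route-repair 2026-08-16; unchanged) — PROVERS / GROUNDERS / REFUTERS: a
Theorems module whose theorem CLOSES an item of this route must NOT import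
Summits.HubbardSuperconductivity.HubbardSuperconductivity.Theses.BalabanIR, directly or transitively
(Theorems.BalabanIRAssembly, Theorems.BalabanIRBirSliceXYOrderRP,
Theorems.BalabanIRBirGroundStateAverageLRO and …Bounds, Theorems.BalabanIRBirEveryGroundState and
its Schur/Closures/Affine/Moments/Pencil/Residue/Samuelson companions,
Theorems.BalabanIRBirComplexStableXYReality and …Slicing, …FixedVolume*,
…GappedPhaseReductionThermal* all DO import it): the gate links `<Decl>_holds := _root_.<thm>` by
importing the closing module INTO this file, and a module that imports this file closes an import
cycle (every decl 'already declared', route unmaterialisable, `closes` unauditable — the rev-3 and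
rev-4 failures). State the closing theorem's TYPE STRUCTURALLY — the item's body verbatim, imports
Summits.HubbardSuperconductivity.Statement + Literature modules + Theses-free helper modules — as
Theorems/ThermalWedgeAssemblyStructural.lean and
Theorems/BalabanIRBirGappedPhaseReductionStructural.lean do (check `example : BalabanIR.<Decl> :=
<thm>` in a scratch file that imports both). Helper files that import this file to name the decls
stay `--supports` files which no closing module imports. For the implication item
BirGappedPhaseReductionR the structural type spells out the antecedent bodies verbatim (`A → B → C`
with A, B, C the bodies; cf. Theorems/BalabanIRAssemblyFrame.lean). The support item
BirSliceXYOrderRP (stmt-HubbardSuperconductivity-2084, the real-XY calibration of the engine's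
slice-order functional) WAS PROVED (Theorems.birSliceXYOrderRP_proof, K₀ = 128, L₀ = 4, even L, M;
2026-08-15) and is detached from the item list since rev 5 only because its closing module imports
this file; it is literally the c = XY-window-table instance of crux 2R's conclusion; refuters keep
its baseline m(K)² ≥ 1 − C/K uniformly in M ≥ L.

Rationale: WHY THIS LINE. Every S-side weak/intermediate-coupling route (WeakCouplingBCS #4,
chiral-window-d-plus-id, intrinsic-large-n-cooper-pairs, PlaquetteBoson's dressing step) leaves the
same last step open: ORDER OF THE PAIR PHASE at T=0 in d=2 once a gap is formed, where the known
rigorous engines need positivity (RP: FrohlichSimonSpencer1976, DysonLiebSimon1978, KLS1988PRL;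
duality/gauge fixing: FrohlichSpencerCMP1982, KennedyKing1986; ferromagnetic positivity:
Garban–Spencer arXiv:2109.01617, in tree as GarbanSpencer2022_xyLongRangeOrder) that itinerant
fermions destroy. Balaban1995/Balaban1996/Balaban1998 + BalabanOcarroll1999 prove magnetisation and
the spin-wave picture of classical N-vector models in d=3 WITHOUT RP by a small-field/large-field
multiscale expansion; d_eff = 2+1 = 3 is exactly the T=0, d=2 case, and weak coupling places the
pair phase exponentially deep inside the convergence region (1/K ~ Δ/E_F: obstruction as resource).
Imported areas: constructive RG (Balaban; BFKT2017 complex small-field technology),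
Osterwalder–Schrader reflection structure (time-reflection Hermiticity of fermion-induced actions),
analytic perturbation theory (Kato1966) + representation theory (Schur) for average→every, BCS/BdG
variational theory (BachLiebSolovej1994, FrankEtAl2012) for the coercivity lemma. New objects
posited: none beyond explicit one-line Lean definitions (sector ground projection, window actions);
no interface/instance split needed.
DESIGN CORRECTIONS TO THE CARD (from reading BFKT2017 pp.2–3 and power counting): (a) the remainder
is NOT relatively small (the fermionic bond energy K·f(Δθ) differs from K(1−cos Δθ) by O(K) at large
twists), so the engine is stated for a CLASS — analytic, U(1)-invariant, complex F with coercive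
real part — not for 'XY + εR'; coercivity is precisely the 'small factor per POINT of a large-field
region' that BFKT could not extract for coherent-state bosons ('explicit purely imaginary terms',
arXiv:1609.00968 p.3) and that the COMPACT pair phase plausibly has: static BdG coercivity (crux 3)
+ Hölder |Tr Π_τ e^{−aH(θ_τ)}| ≤ Π_τ (Tr e^{−MaH(θ_τ)})^{1/M} give it for spatial gradients; (b) the
card's 'milestone 0' (real XY, anisotropic boxes, slice order uniform in M ≫ L²) is provable by RP —
filed as SUPPORT BirSliceXYOrderRP and PROVED (K₀ = 128); (c) Giuliani–Ott 2025 is RP-based (refuter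
audit) — dropped; entry point = Balaban's originals (+ Dimock arXiv:1108.1335 for the method on
φ⁴₃); (d) REV 6 (route-repair 2026-08-16, collating refuter 702958a1, cdisprove Disproof.lean §3–4,
prover seats 0/2 verdicts misstated, TRIAGE-r1-2 §2, crux-ideate r2 ideator-4 NOTES §4): the rev-0
engine class (U1)(N)(A)(C) is TOO LARGE — a complex temporal stiffness is admissible and produces
Beraha–Kahane–Weiss zeros of Z at M ~ K²L⁴ — so the engine is restated as BirComplexStableXYR with
(R) time-reflection Hermiticity c_{n∘R} = conj c_{−n} (kills the witness, makes Z real; automatic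
for Hamiltonian origin) and (P) inversion evenness c_{n∘P} = c_n (makes the spin-wave covariance
real; free for the square lattice and l = 2 pairing), conclusion at even L, M; the reduction is
re-typed as BirGappedPhaseReductionR := BirComplexStableXYR → BirBdGPhaseCoercivity →
BirGroundStateAverageLRO so that crux 3 is a typed input, and (rev 8) the deciding theorem takes the
engine chain itself as hypotheses — `closes (h2R) (h3) (h4R) (hT)`, hX := h4R h2R h3 — so that every
declared crux lies in its item cone (the interim pure-logic glue item BirEngineChainR of rev 7 was
redundant with `closes`, grounded trivial, and dropped); no rev-0 decl was dropped (Theorems modules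
name every one), the two superseded rev-0 items are re-badged support; (e) REV 10 (judge-repair
2026-08-16): the negative lemma that landed on the rev-0 engine record is certified a class artefact
by the support item BirRClassEvenNoZeros (see KILL CRITERIA).
RANKED CRUXES. 2 BirComplexStableXYR (the new theorem; Literature-grade, Hubbard-independent; first
lines to plan: os-real-inversion-real-covariance-frd ≈ abelian-lift-gradient-rg as ONE multiscale
line — real covariance by (R)∧(P), lift/vortex bookkeeping, Haynsworth lemma — with the cheap
support face ginibre-ferromagnetic-cone; workfiles of the rev-0 decl under
Cruxes/BirComplexStableXY/ remain the reading list). 3 BirBdGPhaseCoercivity (static core of the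
dictionary; believed true at every parameter point after six seats of numerics; proved at (μ,Δ₁,Δ₂)
= (0,1,1) with c₀ = 9/100, L ≥ 9 (birBdG_coercive_point011); reduction crux ⇐ frozen-Nambu symbol
inequality landed; open core = band-edge collar μ → ±4 and the limits Δ → 0, ∞ (lines
feshbach-shell-logdet, bcs-dual-persistence, sqrt-concavity-multiplier); SCOPE NOTE for tenure:
prover seats 0/1 ask for a per-point / compact-box variant on the critical path with the ∀ form kept
as research crux — not done in rev 6 because 4R consumes the ∀ form as designed; if 4R's step (2)(C)
turns out to need the Δ-scaling of c₀ (condensation-scale, birBdG_constant_le: c₀ ≤ |Δ₁|+|Δ₂|) or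
block-level coercivity, crux 3 is RESTATED as a new item and 4R's antecedent swapped in the same
edit). 4 BirGappedPhaseReductionR := engine 2R → coercivity 3 → X_avg (fermionic integration below
the gap in a fully gapped chiral B1g+iB2g window, Trotter/time discretisation with even M, canonical
projection = exact integration of the k_s=0 modes; β → ∞ endgame proved Theses-free; carries the
shared WeakCouplingCeiling bet). 5 BirEveryGroundState (average → every, generic U; lines
spectral-curve-anchor (picked), integer-pencil-schur-residue; Schur/pencil/residue/socket glue
landed). Target 0 BirGroundStateAverageLRO (auto-crux since 04:06Z: also attacked directly, line
softmin-pair-penalty picked; derived in-route as h4R h2R h3 inside `closes`). Support: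
BirRClassEvenNoZeros (rev 10: class-artefact certificate — (R), r = 2, even M ⇒ Z real > 0;
provable-now from landed theorems), BirComplexStableXY (rev-0 engine record, superseded; HELD by the
negative lemma modulo WitnessZeroExists = class artefact, see KILL CRITERIA),
BirGappedPhaseReduction (rev-0 reduction record, vacuous modulo the same H; re-typed alive as 4R);
detached-but-proved: BirSliceXYOrderRP. Assembly 1 (proved, bookkeeping).
KILL CRITERIA. Engine 2R refuted inside its own class (an admissible (R)∧(P) table with K→∞ but
slice order < 1/2 or Z = 0 along even L ≤ M — e.g. a dominant complex-conjugate pair of the r ≥ 3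
pseudo-Hermitian multi-slice transfer operator, Disproof §4 caveat; refuter witnesses with complex
stiffness must be checked modulo temporal boosts, ideator-4 §4(c)) → close, unless the refutation is
again a class artefact with an evident Hamiltonian-origin hypothesis missing (then ONE more
restatement, not a series). BdG coercivity refuted for all (μ,Δ₁,Δ₂) in the d+id family (phase
textures lowering the quasi-free energy, flux-phase style) → the coercive class is wrong for
Hubbard: close unless crux 2R survives with a weaker large-field hypothesis. One-page power counting
showing the fermion-induced F violates analyticity/quasi-locality/(C)-at-the-needed-scale even in
the nodeless window → close. BirEveryGroundState refuted (systematic all-U reducible ground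
multiplets on even tori) → pivot to GS-uniqueness hypotheses shared with generic-u-schur-every-gs /
mesoscopic-source-selection. A proof that the weak-coupling GS is non-superconducting at every δ <
1/2 kills X_avg and the route. A landed ¬BirComplexStableXY, or the NEGATIVE LEMMA modulo H that did
land on that rev-0 record (BirComplexStableXY_false_of_WitnessZeroExists : WitnessZeroExists →
¬BirComplexStableXY, hold on stmt-2080 since 2026-08-16T06:24Z), does NOT kill the line and needs NO
further repair: the record is superseded support outside the cone of `closes`, and the lemma is a
CLASS ARTEFACT — its witnesses have complex temporal stiffness ε₁ ≠ 0, i.e. violate (R)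
(`witness_not_timeReflectionHermitian`), while in class (R) with r = 2 the engine's Z is real > 0 at
every even M (`birEven_partitionFunction_pos`, landed; filed as the certificate item
BirRClassEvenNoZeros, rev 10); do NOT drop the rev-0 decls (≥ 12 accepted Theorems modules and the
Negative lemma module name them).
NOT DECOMPOSED YET. The multiscale expansion itself (small/large-field induction, complex
translation of contours, extraction of the per-point factor from coercivity, the extensive sign free
energy ~|Λ|/K that forces a locality-tracking expansion on a real-covariance backbone); the
anisotropy / scale refinement the reduction will probably need (spatial-only coercivity +
Gaussian/Berry control of temporal gradients; condensation-scale vs stiffness-scale coercivity; then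
crux 3 or 2R is RESTATED as a new item, not split); exponential (not finite-range) tails of F and
summable infinite tables in (A); the two-regime fermionic expansion above Δ (lives in
WeakCouplingBCS #4 / chiral-window-d-plus-id); the chiral window's location (needs the B1g/B2g
Kohn–Luttinger crossing inside δ < 1/2, RaghuKivelsonScalapino2010 Fig. 2); Z, ψ_{B1g} bookkeeping;
the thermal/frequent-β intermediate form of X_avg (bridge already proved, not filed as a node to
avoid a duplicate staffed target).
CHEAPEST FALSIFIER. For 2R: the r = 2 and r = 3 (R)∧(P)-class rotor/transfer chains at L = 1, 2 —
look for a dominant complex-conjugate eigenvalue pair or a sign change of the REAL function K ↦ Z_M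
in any charge sector (scripts and baselines: Disproof.lean §4 docstring j004976/j014044, ideator-4
kit j014566: none found for κ ∈ {4,…,32}, ε ≤ 0.3, η ≤ 3); for 3: 20×20 BdG spectra against
vortex/flux textures at the band-edge collar μ ∈ (−3.9,−3.3), small Δ (the frozen symbol (★) is
already negative there while the crux is believed true — a genuine texture beating the uniform state
kills it); for 4R: one-page power counting of the fermion-induced window action's (A)/(C) constants
against K ~ E_F/Δ.

Novelty: Searched this session (searchd/OpenAlex/S2/arXiv down or HTTP 429; zbMATH, Crossref, galaxy and lit
read worked): zbMATH 'Balaban N-vector low temperature expansion' → Balaban1995, Balaban1996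
(10.1007/bf02506422), Balaban1998 (10.1007/s002200050433), Balaban 1995 Palaiseau proceedings
zbl:0825.81011; zbMATH 'power series representations complex bosonic effective actions' → BFKT I–III
(10.1063/1.3329425, 10.1063/1.3329938, 10.4171/aihpd/64) + BFKT2017 (read, pp.2–3); zbMATH 'complex
measure low temperature expansion spontaneous magnetization continuous symmetry' → 0; 'Pirogov-Sinai
theory complex interactions continuous spins' → 0 (BorgsImbrie1989 found separately: complex
couplings, DISCRETE spins only); 'superfluid density lower bound BCS theory rigorous' → 0; Crossref
'Microscopic derivation of Ginzburg-Landau theory' → FrankEtAl2012 (small-twist energy ≈ GL ≥ 0,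
continuum, no global lattice coercivity); galaxy --star all 'low temperature expansion' → Dimock
arXiv:1108.1335 (expository, φ⁴₃), 'complex bosonic effective action' → Les Houches 2010 volume;
tree: XYOrder*.lean (quantum KLS, RP), BalabanRG*.lean (gauge-theory block RG, schematic). Nearest
prior art: Balaban1995–1998 + BalabanOcarroll1999 (REAL actions, isotropic boxes, magnetisation in a
field) and the BFKT programme (complex actions for BOSONS; symmetry-broken infrared regime and
per-point large-field factors explicitly open). Delta (new-combination, with one new ingredient):
(i) the engine is posed for the cl  [refs: 10.1007/bf02506422, 10.1007/s002200050433, 10.1063/1.3329425, 10.1063/1.3329938, 10.4171/aihpd/64, 1108.1335, Balaban1995, Balaban1996, Balaban1998, BFKT2017, BorgsImbrie1989, FrankEtAl2012, BalabanOcarroll1999]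

Barriers (technique_class: multiscale-low-T-expansion complex-action constructive-RG): technique_class: multiscale-low-T-expansion complex-action constructive-RG
(catalogue Literature/Barriers/HubbardSuperconductivity: all 10 entries read; one line each.)
Literature.Barriers.HubbardSuperconductivity.WeakCouplingCeiling: APPLIES to BirGappedPhaseReduction
(the input above the gap scale: no convergent expansion is proved below T ~ e^{−a/|U|}, BGM2006 Thm
1.1 only at density < 1/4) and is NOT evaded — shared two-regime bet with WeakCouplingBCS #4; the
engine itself (crux 2) runs BELOW the gap in the parameter 1/K ~ Δ/E_F, not in U, and cruxes 2, 3, 5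
are barrier-free statements.
Literature.Barriers.HubbardSuperconductivity.PerturbativeInvisibilityOfPairing: respected — Δ, ξ, K
enter as scales of a resummed symmetry-broken reference; nothing is read off a truncated U-series; K
~ e^{+1/(αρ²U²)} is itself invisible at U = 0⁺ (obstruction as resource).
Literature.Barriers.HubbardSuperconductivity.PerturbativeInvisibilityOfPairingNarrow: idem; the only
perturbatively visible input is the Kohn–Luttinger B1g/B2g channel structure locating the window
(WeakCouplingBCS #3 territory).
Literature.Barriers.HubbardSuperconductivity.LROForcesLowLyingStates: respected — order is
GS-AVERAGE / every-GS two-point LRO of symmetric finite tori (evasion (i)); the U(1) tower = the k_s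
= 0 temporal modes of θ, integrated exactly (they implement the canonical projection), never gapped
out; no uniform-gap continuation is used; BirEveryGroundState works inside the
degenerate/near-degenerate

Novelty grade: new-combination — REVIEW (refuter 08-15). All 8 decls rc0; Assembly proved sorry-free (evidence on stmt-2085). Target 2079 NON-VACUOUS: minEnergyOn = attained sInf of Rayleigh values, hubbardTorus Hermitian & N/S^z-conserving (tree hamiltonian_isHermitian_and_commute_holds) ⇒ E₀≠⊥, tr P ≥ 1; c·L⁴ matches unnormalised (refuter refuter-rreview-route-PneNP-EcdlpDefinab-f574c8f2-0, 2026-08-15T14:01:43Z; prior: Balaban1996 doi:10.1007/bf02506422, Balaban1998 doi:10.1007/s002200050433, BalabanOCarroll1999, BFKT2017 arXiv:1609.00968, BFKT-I doi:10.1063/1.3329425, BorgsImbrie1989, FrankEtAl2012, Dimock2011 arXiv:1108.1335)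

History (route lifecycle, newest last):
- 2026-08-15T23:00:19Z · rev 4: restated Assembly (stmt-HubbardSuperconductivity-2085 proved) — route-repair (glue-native-fail) rev 4: the deciding theorem was never wrong (glue.native ok=true on the rev-3 text; lean check of the on-disk file rc0, #h21_che (planner-rglue-HubbardSuperconductivity-Balaba-dbfb022a-0)
- 2026-08-16T00:49:47Z · rev 5: dropped BirSliceXYOrderRP — route-repair (glue.unproved) rev 5: `closes` was never wrong (glue.native ok=true; same text re-supplied) — the route stopped MATERIALISING at 2026-08-16T00:37Z (planner-rbadge-HubbardSuperconductivity-Balaba-dbfb022a-g2-0)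
- 2026-08-16T04:06:14Z · AUTO-CRUX (backfill): BirGroundStateAverageLRO — hypotheses of the deciding theorem that nothing in the route derives are cruxes (operator:999:1085951)
- 2026-08-16T06:38:11Z · rev 8: dropped BirEngineChainR — route-repair (unused-crux) rev 8: deciding theorem now takes the engine chain as hypotheses — closes (h2R : BirComplexStableXYR) (h3 : BirBdGPhaseCoercivity) (h (planner-rrepair-HubbardSuperconductivity-Balab-4505dd6b-0)
- 2026-08-24T06:57:35Z · DORMANT — reconciler: no traction for 6.6 d (last activity item-evidence-added at 2026-08-17T16:35:25Z); parked, not closed — `ledger route dormant route-HubbardSupercond (operator:999:3863284)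
- 2026-08-26T04:25:02Z · REACTIVATED — reconciler: reactivated — activity item-evidence-added at 2026-08-25T20:00:02Z after parking at 2026-08-24T06:57:35Z (operator:999:2606452)

sub-problem: HubbardSuperconductivity · status: open · opened planner-plancard-HubbardSuperconductivity-Hub-c21b4d64-0 2026-08-15T11:00:36Z · rev 11 · ledger route-HubbardSuperconductivity-BalabanIR
GENERATED by the gate from the ledger (D-0016/17). Provers cite these decls: `theorem foo : Summit.HubbardSuperconductivity.HubbardSuperconductivity.Theses.BalabanIR.<Decl> := …` in Summits/HubbardSuperconductivity/HubbardSuperconductivity/Theorems/<Name>.lean.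
-/

namespace Summit.HubbardSuperconductivity.HubbardSuperconductivity.Theses.BalabanIR

open scoped BigOperators Topology Manifold Classical MeasureTheory ProbabilityTheory Matrix InnerProductSpace ComplexConjugate ContinuousMap
open Filter Set Function TopologicalSpace MeasureTheory

attribute [summit_statement] _root_.HubbardSuperconductivity

open Literature.Hubbard

/-- item stmt-HubbardSuperconductivity-2079 · crux (kind.auto-crux: conjecture-grade) · rank 0 · open · by planner
why it might fail: Asks GS-AVERAGE d-wave pair LRO on an open WINDOW of weak U at one δ<1/2: false if the weak-coupling GS is non-superconducting at every δ<1/2, if LRO holds only at isolated U, or if the fully gapped chiral window sits at δ≥1/2; nodal pure d-wave may leave the engine class.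
sources: RaghuKivelsonScalapino2010, ArovasBergKivelsonRaghu2022, DengEtAl2015, QinEtAl2020, idea:HubbardSuperconductivity/HubbardSuperconductivity/complex-stable-balaban-ir-engine
[target] X_avg, the engine's Hubbard-side output. For some δ ∈ (0,1/2), an open window (U₁,U₂) ⊂
(0,∞) of couplings and c > 0: for every U in the window, eventually in even L, the uniform average
over the ground eigenspace E₀ = szSector N_L 0 ⊓ ker(H − e₀), e₀ = H.minEnergyOn (szSector N_L 0), H
= hubbardTorus 2 L 1 U, N_L = 2⌊(1−δ)L²/2⌋, of Δ_d†Δ_d (Δ_d = pairField dWaveFormFactor L) is ≥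
c·L⁴: written basis-free as c·L⁴·Re tr P ≤ Re tr(P·Δ_d†Δ_d) with P = QuantumLattice.projMatrix (E₀
mapped to EuclideanSpace by Fock.toEuclidean) (tr P = dim E₀ ≥ 1 for a Hermitian sector-preserving
H; both traces are real). A WINDOW of U (not one U) is asked because crux 5 converts average→every
only off a countable set of couplings. Intended mechanism: cruxes 2–4 (positivity-free infrared
engine in a fully gapped weak-coupling window; the d+id reference still has a non-zero B1g
component, so Δ_d†Δ_d — the summit's own d_{x²−y²} functional — is what is bounded). Why it might
fail: see why_might_fail. Sources: RaghuKivelsonScalapino2010 §III Fig. 2 (channel structure at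
t'=0), ArovasBergKivelsonRaghu2022 §5.1, DengEtAl2015 (emergent BCS regime U ≤ 4, n < 0.7),
QinEtAl2020 §I. -/
@[route_item "route-HubbardSuperconductivity-BalabanIR", crux]
def BirGroundStateAverageLRO : Prop :=
  ∃ δ ∈ Set.Ioo (0:ℝ) (1/2), ∃ U₁ U₂ c : ℝ, 0 < U₁ ∧ U₁ < U₂ ∧ 0 < c ∧ ∀ U ∈ Set.Ioo U₁ U₂, ∃ L₀ : ℕ, ∀ (L : ℕ) [NeZero L], L₀ ≤ L → Even L → let N : ℕ := 2 * ⌊(1 - δ) * (L : ℝ) ^ 2 / 2⌋₊; let H := Literature.MathematicalPhysics.QuantumLattice.hubbardTorus 2 L 1 U; let S := Literature.MathematicalPhysics.QuantumLattice.szSector (Λ := Literature.MathematicalPhysics.QuantumLattice.FermionTorus 2 L) N 0; let E₀ := S ⊓ Module.End.eigenspace (Matrix.toLin' H) ((H.minEnergyOn S : ℝ) : ℂ); let P := Literature.MathematicalPhysics.QuantumLattice.projMatrix (E₀.map (Literature.MathematicalPhysics.QuantumLattice.Fock.toEuclidean (ι := Literature.MathematicalPhysics.QuantumLattice.Orb (Literature.MathematicalPhysics.QuantumLattice.FermionTorus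 2 L)) : Literature.MathematicalPhysics.QuantumLattice.Fock (Literature.MathematicalPhysics.QuantumLattice.Orb (Literature.MathematicalPhysics.QuantumLattice.FermionTorus 2 L)) →ₗ[ℂ] EuclideanSpace ℂ (Finset (Literature.MathematicalPhysics.QuantumLattice.Orb (Literature.MathematicalPhysics.QuantumLattice.FermionTorus 2 L))))); c * (L : ℝ) ^ 4 * P.trace.re ≤ (P * (Matrix.conjTranspose (Literature.MathematicalPhysics.QuantumLattice.pairField Literature.MathematicalPhysics.QuantumLattice.dWaveFormFactor L) * Literature.MathematicalPhysics.QuantumLattice.pairField Literature.MathematicalPhysics.QuantumLattice.dWaveFormFactor L)).trace.re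

/-- item stmt-HubbardSuperconductivity-14845 · crux · rank 2 · open · by planner
why it might fail: Even in the (R)∧(P) class no positivity-free control of COMPLEX large fields exists (BFKT: one small factor per REGION, not per point); for r≥3 the multi-slice transfer operator is only pseudo-Hermitian (dominant conjugate pair ⇒ real Z changes sign); sign free energy ~|Λ|/K is extensive.
sources: Balaban1996, Balaban1998, BalabanOcarroll1999, BFKT2017, 10.1063/1.3329425, arXiv:2109.01617
[crux] THE ENGINE, RESTATED (C′; rev 6; supersedes BirComplexStableXY, whose typed form — Z ≠ 0 ∧
slice order ≥ 1/2 for ALL M ≥ L at fixed K — is refuted in substance by Beraha–Kahane–Weiss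
transfer-operator zeros of Z = Tr T^M at M ~ K²L⁴ for the ADMISSIBLE complex-temporal-stiffness
table `witness ε₁ ε₂`: rreview 702958a1 Crux2_TransferZeros.md;
Cruxes/BirComplexStableXY/Disproof.lean §3, `witness_admissible` sorry-free; prover seat 0 verdict
misstated ×5; Theorems…FixedVolumeUniform `birFixedVolume_uniform_stable` isolates the false content
as (L,M)-uniformity of K₁). Same sites Λ = (ℤ/L)²×(ℤ/M), window W_r = Fin r³, finite Fourier table
c, hypotheses (U1) Σ_w n_w = 0 on supp c, (N) Σ c_n = 0, (A) Σ|c_n|e^{|n|₁} ≤ B, (C) Re F ≥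
c₀ΣΣ(1−cos(φ_w−φ_w')), PLUS (R) time-reflection (Osterwalder–Schrader) Hermiticity c_{n∘R} = conj
c_{−n}, R(a,b,t) = (a,b,r−1−t), i.e. F(φ∘R) = conj F(φ) — automatic for every action obtained by
integrating out the fermions of a Hamiltonian model in imaginary time; it excludes the witness
(`witness_not_timeReflectionHermitian`), makes Z real (`partZ_conj_of_OS`) and, for r = 2, positive
at even M (`birEven_partitionFunction_pos`, Theorems…EvenPositivity) -/
@[route_item "route-HubbardSuperconductivity-BalabanIR", crux]
def BirComplexStableXYR : Prop :=
  ∀ (r : ℕ) (B c₀ : ℝ), 2 ≤ r → 0 < c₀ → ∃ K₀ : ℝ, ∃ L₀ : ℕ, ∀ K : ℝ, K₀ ≤ K → ∀ c : ((Fin r × Fin r × Fin r) → ℤ) →₀ ℂ, (∀ n ∈ c.support, ∑ w, n w = 0) → c.sum (fun _ a => a) = 0 → c.sum (fun n a => ‖a‖ * Real.exp (∑ w, |(n w : ℝ)|)) ≤ B → (∀ φ : (Fin r × Fin r × Fin r) → ℝ, c₀ * ∑ w, ∑ w', (1 - Real.cos (φ w - φ w')) ≤ ((fun (φ : (Fin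 r × Fin r × Fin r) → ℝ) => c.sum (fun n a => a * Complex.exp (Complex.I * ((∑ w, (n w : ℝ) * φ w : ℝ) : ℂ)))) φ).re) → (∀ n : (Fin r × Fin r × Fin r) → ℤ, c (fun w => n (w.1, w.2.1, Fin.rev w.2.2)) = (starRingEnd ℂ) (c (-n))) → (∀ n : (Fin r × Fin r × Fin r) → ℤ, c (fun w => n (Fin.rev w.1, Fin.rev w.2.1, w.2.2)) = c n) → ∀ (L M : ℕ) [NeZero L] [NeZero M], L₀ ≤ L → L ≤ M → Even L → Even M → let sh : (Literature.Probability.LatticeModels.TorusSite 2 L × ZMod M) → (Fin r × Fin r × Fin r) → (Literature.Probability.LatticeModels.TorusSite 2 L × ZMod M) := fun s w => (s.1 + ![((w.1 : ℕ) : ZMod L), ((w.2.1 : ℕ) : ZMod L)], s.2 + ((w.2.2 : ℕ) : ZMod M)); let F : ((Fin r × Fin r × Fin r) → ℝ) → ℂ := fun (φ : (Fin r × Fin r × Fin r) → ℝ) => c.sum (fun n a => a * Complex.exp (Complex.I * ((∑ w, (n w : ℝ) * φ w : ℝ) : ℂ))); let A : ((Literature.Probability.LatticeModels.TorusSite 2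 L × ZMod M) → ℝ) → ℂ := fun θ => (K : ℂ) * ∑ s : (Literature.Probability.LatticeModels.TorusSite 2 L × ZMod M), F (fun w => θ (sh s w)); let cube : Set ((Literature.Probability.LatticeModels.TorusSite 2 L × ZMod M) → ℝ) := Set.pi Set.univ (fun _ => Set.Icc (0:ℝ) (2 * Real.pi)); let Z : ℂ := MeasureTheory.integral (MeasureTheory.volume.restrict cube) (fun θ => Complex.exp (-(A θ))); let O : ((Literature.Probability.LatticeModels.TorusSite 2 L × ZMod M) → ℝ) → ℝ := fun θ => ‖∑ x : Literature.Probability.LatticeModels.TorusSite 2 L, Complex.exp (Complex.I * (θ (x, 0) : ℂ))‖ ^ 2 / (L : ℝ) ^ 4; Z ≠ 0 ∧ (1/2 : ℝ) ≤ ((MeasureTheory.integral (MeasureTheory.volume.restrict cube) (fun θ => (O θ : ℂ) * Complex.exp (-(A θ)))) / Z).re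

/-- item stmt-HubbardSuperconductivity-2081 · crux · rank 3 · closed · proved by Summit.HubbardSuperconductivity.HubbardSuperconductivity.Theorems.BirBdG.birBdGPhaseCoercivity_proof (prover) · by planner
why it might fail: Global coercivity is unproved even for s-wave BCS: phase textures can LOWER quasi-free lattice-fermion energies (Lieb1994: pi-flux optimal at half filling); c0 ~ min(rho_s, Delta^2) must be L-uniform and >0 on the whole (mu,D1,D2) range; may degenerate as mu->+-4 or D2->0, or fail at strong Delta.
sources: Lieb1994, BachLiebSolovej1994, FrankEtAl2012, HainzlSeiringer2016, RaghuKivelsonScalapino2010, idea:HubbardSuperconductivity/HubbardSuperconductivity/complex-stable-balaban-ir-engine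
[crux] STATIC CORE OF THE COERCIVITY HYPOTHESIS (cheaply falsifiable; quasi-free fermions only). On
the torus (ℤ/L)² take the spin-singlet Bogoliubov–de Gennes matrix Hb(θ) = fromBlocks h D(θ) D(θ)ᴴ
(−h) on particle ⊕ hole indices, with h = −(nearest-neighbour adjacency) − μ·1 (t = 1, t' = 0, μ ∈
(−4,4) = band interior) and the chiral d+id pairing matrix D(θ)_{xy} = (Δ₁·g_{x²−y²}(y−x) +
i·Δ₂·g_{xy}(y−x)) · (e^{iθ_x} + e^{iθ_y})/2, g_{x²−y²} = ±1 on ±e₁ / ±e₂ bonds, g_{xy} = ±1 on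
±(e₁+e₂) / ±(e₁−e₂) diagonals (fully gapped for Δ₁, Δ₂ ≠ 0, μ ∈ (−4,4): the gap function 2Δ₁(cos k₁
− cos k₂) − 4iΔ₂ sin k₁ sin k₂ vanishes only at k ∈ {0,(π,π)} where |ξ_k| = |∓4 − μ| > 0). The
quasi-free ground-state energy is E(θ) = −½ Σ_i |λ_i(Hb(θ))| + const. CLAIM (phase rigidity as a
GLOBAL lattice inequality): ∀ μ ∈ (−4,4), Δ₁ ≠ 0, Δ₂ ≠ 0 ∃ c₀ > 0, L₀ ∀ L ≥ L₀ ∀ θ : (ℤ/L)² → ℝ: Σ_i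
|λ_i(Hb(0))| − Σ_i |λ_i(Hb(θ))| ≥ c₀ Σ_{⟨xy⟩} (1 − cos(θ_x − θ_y)) (typed with ∀ over the
IsHermitian proofs, which exist: h real symmetric, D symmetric). ROLE: with Hölder's inequality |Tr
Π_τ e^{−aHb(θ_τ)}| ≤ Π_τ (Tr e^{−M a Hb(θ_τ)})^{1/M} it yields |fermionic weight of a space-time
phase configuration| ≤ exp(−a·c₀·Σ_ -/
@[route_item "route-HubbardSuperconductivity-BalabanIR", crux]
def BirBdGPhaseCoercivity : Prop :=
  ∀ (μ Δ₁ Δ₂ : ℝ), μ ∈ Set.Ioo (-4:ℝ) 4 → Δ₁ ≠ 0 → Δ₂ ≠ 0 → ∃ c₀ : ℝ, 0 < c₀ ∧ ∃ L₀ : ℕ, ∀ (L : ℕ) [NeZero L], L₀ ≤ L → let nnx : Literature.Probability.LatticeModels.TorusSite 2 L → Literature.Probability.LatticeModels.TorusSite 2 L → Prop := fun x y => y = x + ![1, 0] ∨ y = x + ![-1, 0]; let nny : Literature.Probability.LatticeModels.TorusSite 2 L → Literature.Probability.LatticeModels.TorusSite 2 L → Prop := fun x y => y = x + ![0, 1]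 ∨ y = x + ![0, -1]; let dg1 : Literature.Probability.LatticeModels.TorusSite 2 L → Literature.Probability.LatticeModels.TorusSite 2 L → Prop := fun x y => y = x + ![1, 1] ∨ y = x + ![-1, -1]; let dg2 : Literature.Probability.LatticeModels.TorusSite 2 L → Literature.Probability.LatticeModels.TorusSite 2 L → Prop := fun x y => y = x + ![1, -1] ∨ y = x + ![-1, 1]; let h : Matrix (Literature.Probability.LatticeModels.TorusSite 2 L) (Literature.Probability.LatticeModels.TorusSite 2 L) ℂ := fun x y => -(if nnx x y ∨ nny x y then (1 : ℂ) else 0) - (if x = y then (μ : ℂ) else 0); let D : (Literature.Probability.LatticeModels.TorusSite 2 L → ℝ) → Matrix (Literature.Probability.LatticeModels.TorusSite 2 L) (Literature.Probability.LatticeModels.TorusSite 2 L) ℂ := fun θ x y => ((Δ₁ : ℂ) * ((if nnx x y then (1 : ℂ) else 0) - (if nny x y then (1 : ℂ) else 0)) + Complex.I * (Δ₂ : ℂ) * ((if dg1 x y then (1 : ℂ) else 0) - (if dg2 x y then (1 : ℂ) else 0))) * (Complex.exp (Complex.I * (θ x : ℂ)) + Complex.exp (Complex.I * (θ y : ℂ)))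 / 2; let Hb : (Literature.Probability.LatticeModels.TorusSite 2 L → ℝ) → Matrix (Literature.Probability.LatticeModels.TorusSite 2 L ⊕ Literature.Probability.LatticeModels.TorusSite 2 L) (Literature.Probability.LatticeModels.TorusSite 2 L ⊕ Literature.Probability.LatticeModels.TorusSite 2 L) ℂ := fun θ => Matrix.fromBlocks h (D θ) (Matrix.conjTranspose (D θ)) (-h); ∀ θ : Literature.Probability.LatticeModels.TorusSite 2 L → ℝ, ∀ (hθ : (Hb θ).IsHermitian) (h0 : (Hb (fun _ => 0)).IsHermitian), c₀ * ∑ x : Literature.Probability.LatticeModels.TorusSite 2 L, ∑ y : Literature.Probability.LatticeModels.TorusSite 2 L, (if nnx x y ∨ nny x y then (1 - Real.cos (θ x - θ y)) else 0) ≤ ∑ i, |h0.eigenvalues i| - ∑ i, |hθ.eigenvalues i|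

/-- `BirBdGPhaseCoercivity` holds: proved by `Summit.HubbardSuperconductivity.HubbardSuperconductivity.Theorems.BirBdG.birBdGPhaseCoercivity_proof`. -/
theorem BirBdGPhaseCoercivity_holds : BirBdGPhaseCoercivity := _root_.Summit.HubbardSuperconductivity.HubbardSuperconductivity.Theorems.BirBdG.birBdGPhaseCoercivity_proof

/-- item stmt-HubbardSuperconductivity-14846 · crux · rank 4 · open · by planner
why it might fail: Needs (i) a convergent fermionic expansion below T~e^{-a/U²} at δ<1/2 (WeakCouplingCeiling: nothing proved), (ii) a fully gapped chiral d+id window at t'=0 inside δ<1/2, (iii) the induced action INSIDE class 2R with (A),(C) at the scale crux 3 delivers (condensation-scale c₀; exponential tails).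
sources: BenfattoGiulianiMastropietro2006, FeldmanKnorrerTrubowitz2004, Mastropietro2008, Salmhofer1999, RaghuKivelsonScalapino2010, BFKT2017
[crux] THE REDUCTION, RE-TYPED (rev 6; supersedes BirGappedPhaseReduction := BirComplexStableXY →
BirGroundStateAverageLRO, which rreview f574c8f2 / grounder g16-17 / prover seat 2 (verdict
misstated s3, s4, s6) correctly read as glue over a refuted-in-substance engine):
BirComplexStableXYR → BirBdGPhaseCoercivity → BirGroundStateAverageLRO — the constructive-fermion
half of the dictionary now CONSUMES the restated engine (crux 2R) AND the static BdG phase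
coercivity (crux 3) explicitly, as the design always intended (crux 3 ROLE ¶; step (2)(C) below).
CONTENT (informal): at weak coupling and a doping δ < 1/2 in a FULLY GAPPED pairing window of the
t'=0 Hubbard model (intended instance: the chiral B1g+iB2g window near the Kohn–Luttinger B1g/B2g
crossing, RaghuKivelsonScalapino2010 Fig. 2 puts it near n ≈ 0.6), (1) a two-regime multiscale
fermionic expansion (Fermi-liquid regime FeldmanKnorrerTrubowitz2004 /
BenfattoGiulianiMastropietro2006 down to the gap scale Δ ~ e^{−C/U²}, then a symmetry-broken
expansion around the gapped d+id BdG reference, cf. Mastropietro2008 Ch. 15) integrates out the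
fermions in the background of a block pair-phase field θ (blocks of side ξ = v_F/Δ, Trotte -/
@[route_item "route-HubbardSuperconductivity-BalabanIR", crux]
def BirGappedPhaseReductionR : Prop :=
  BirComplexStableXYR → BirBdGPhaseCoercivity → BirGroundStateAverageLRO

/-- item stmt-HubbardSuperconductivity-2083 · crux · rank 5 · open · by planner
why it might fail: Average=>every needs the sector ground eigenspace to be an IRREDUCIBLE multiplet of the torus symmetry group for generic U (Rellich-Kato + Schur); a systematic all-U degeneracy of distinct irreps (hidden symmetry, chiral doublets, shell effects) defeats it; no such theorem exists for Hubbard tori.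
sources: Kato1966, KomaTasaki1994, Tasaki2019Tower, Literature.Barriers.HubbardSuperconductivity.LROForcesLowLyingStates, idea:HubbardSuperconductivity/HubbardSuperconductivity/generic-u-schur-every-gs, idea:HubbardSuperconductivity/HubbardSuperconductivity/mesoscopic-source-selection
[crux] AVERAGE → EVERY (shared need of every functional-integral or source-based route; cf. cards
generic-u-schur-every-gs, mesoscopic-source-selection and WeakCouplingBCS #2). CLAIM: for δ ∈
(0,1/2), 0 < U₁ < U₂, c > 0: if for every U ∈ (U₁,U₂) the sector ground-state AVERAGE of Δ_d†Δ_d is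
≥ c·L⁴ eventually in even L (same basis-free formulation as the target), then for SOME U ∈ (U₁,U₂)
the summit's matrix HasDWavePairFieldLROAt U δ holds (every normalised (N_L, S^z=0)-sector
ground-state sequence has d_{x²−y²} pair-field LRO along even sides). Intended proof: for each even
L the sector Hamiltonian is affine in U, so (Rellich/Kato1966 II §6) eigenvalues and
eigenprojections are analytic branches off a finite exceptional set B_L; the symmetry group G_L
(translations ⋊ D₄, spin rotations, particle–hole-type maps where available) acts on the ground
eigenspace E₀(U,L); CLAIMED GENERICITY: off a countable set B = ⋃_L B_L ∪ {systematic coincidences},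
E₀(U,L) is a single irreducible G_L-multiplet for all large even L, whence by Schur the
G_L-invariant positive operator P_{E₀}Δ_d†Δ_dP_{E₀} is a scalar on E₀ and EVERY normalised ground
state has ⟨Δ_d†Δ_d⟩ = average ≥ cL⁴; pick U ∈ (U₁,U₂) -/
@[route_item "route-HubbardSuperconductivity-BalabanIR", crux]
def BirEveryGroundState : Prop :=
  ∀ (δ U₁ U₂ c : ℝ), δ ∈ Set.Ioo (0:ℝ) (1/2) → 0 < U₁ → U₁ < U₂ → 0 < c → (∀ U ∈ Set.Ioo U₁ U₂, ∃ L₀ : ℕ, ∀ (L : ℕ) [NeZero L], L₀ ≤ L → Even L → let N : ℕ := 2 * ⌊(1 - δ) * (L : ℝ) ^ 2 / 2⌋₊; let H := Literature.MathematicalPhysics.QuantumLattice.hubbardTorus 2 L 1 U; let S := Literature.MathematicalPhysics.QuantumLattice.szSector (Λ := Literature.MathematicalPhysics.QuantumLattice.FermionTorus 2 L) N 0; let E₀ := S ⊓ Module.End.eigenspace (Matrix.toLin' H) ((H.minEnergyOn S : ℝ) : ℂ); let P := Literature.MathematicalPhysics.QuantumLattice.projMatrix (E₀.map (Literature.MathematicalPhysics.QuantumLattice.Fock.toEuclidean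 (ι := Literature.MathematicalPhysics.QuantumLattice.Orb (Literature.MathematicalPhysics.QuantumLattice.FermionTorus 2 L)) : Literature.MathematicalPhysics.QuantumLattice.Fock (Literature.MathematicalPhysics.QuantumLattice.Orb (Literature.MathematicalPhysics.QuantumLattice.FermionTorus 2 L)) →ₗ[ℂ] EuclideanSpace ℂ (Finset (Literature.MathematicalPhysics.QuantumLattice.Orb (Literature.MathematicalPhysics.QuantumLattice.FermionTorus 2 L))))); c * (L : ℝ) ^ 4 * P.trace.re ≤ (P * (Matrix.conjTranspose (Literature.MathematicalPhysics.QuantumLattice.pairField Literature.MathematicalPhysics.QuantumLattice.dWaveFormFactor L) * Literature.MathematicalPhysics.QuantumLattice.pairField Literature.MathematicalPhysics.QuantumLattice.dWaveFormFactor L)).trace.re) → ∃ U ∈ Set.Ioo U₁ U₂, ∀ (N : ℕ → ℕ) (ψ : ∀ L, Literature.MathematicalPhysics.QuantumLattice.Fock (Literature.MathematicalPhysics.QuantumLattice.Orb (Literature.MathematicalPhysics.QuantumLattice.FermionTorus 2 L))), (∀ L, Even L → N L = 2 * ⌊(1 - δ) * (L : ℝ) ^ 2 / 2⌋₊ ∧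 star (ψ L) ⬝ᵥ ψ L = 1 ∧ Literature.MathematicalPhysics.QuantumLattice.IsGroundStateInSector (Literature.MathematicalPhysics.QuantumLattice.hubbardTorus 2 L 1 U) (N L) 0 (ψ L)) → Literature.Probability.LatticeModels.HasLongRangeOrder (fun k => Literature.Probability.LatticeModels.halfOpenBox 2 (2 * k)) (fun k => Literature.MathematicalPhysics.QuantumLattice.torusPullback (Literature.MathematicalPhysics.QuantumLattice.pairFieldCorr Literature.MathematicalPhysics.QuantumLattice.dWaveFormFactor ψ) (2 * k))

/-- item stmt-HubbardSuperconductivity-2080 · support · rank 2 · open · by planner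
why it might fail: No positivity-free control of COMPLEX large-field regions exists: BFKT get one small factor per large-field REGION, not per point (arXiv:1609.00968 p.3); coercivity may not beat complex cancellations or Lee-Yang zeros (Z=0); uniformity in M>>L^2 and the real-case induction are untested.
sources: Balaban1995, Balaban1996, Balaban1998, BalabanOcarroll1999, BFKT2017, 10.1063/1.3329425
[crux] THE ENGINE (new theorem; classical statistical mechanics, independent of Hubbard). Sites Λ =
(ℤ/L)² × (ℤ/M) (TorusSite 2 L × ZMod M), angles θ : Λ → ℝ with product Lebesgue measure on [0,2π]^Λ.
Window W_r = Fin r³, shift sh s w = s + w. Local generating function F(φ) = Σ_n c_n e^{i n·φ} given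
by a finitely supported Fourier table c : (W_r → ℤ) →₀ ℂ with (U1) Σ_w n_w = 0 on the support
(global U(1) invariance), (N) Σ_n c_n = 0 (F vanishes at constant configurations), (A) Σ_n |c_n|
e^{|n|₁} ≤ B (analyticity in the strip |Im φ| < 1), (C) Re F(φ) ≥ c₀ Σ_{w,w'} (1 − cos(φ_w −
φ_{w'})) for all real φ (COERCIVITY: the real part penalises every misalignment inside the window —
this is the 'small factor per large-field point' taken as a hypothesis). Action A(θ) = K·Σ_{s∈Λ}
F(θ∘sh s), complex weight e^{−A}. CLAIM: ∀ r ≥ 2, B, c₀ > 0 ∃ K₀, L₀ ∀ K ≥ K₀ ∀ admissible c ∀ L₀ ≤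
L ≤ M: Z = ∫e^{−A} ≠ 0 and Re(∫ O e^{−A} / Z) ≥ 1/2 for the EQUAL-TIME slice order O(θ) = |L⁻² Σ_x
e^{iθ(x,0)}|² (so m(K)² ≥ 1/2; in the real XY case 1 − O(1/K)). Uniform in M ≥ L INCLUDING M ≫ L²
(there the space-time magnetisation vanishes through the k_s = 0 rotor modes, but slice order does
not). The real nearest -/
@[route_item "route-HubbardSuperconductivity-BalabanIR", crux]
def BirComplexStableXY : Prop :=
  ∀ (r : ℕ) (B c₀ : ℝ), 2 ≤ r → 0 < c₀ → ∃ K₀ : ℝ, ∃ L₀ : ℕ, ∀ K : ℝ, K₀ ≤ K → ∀ c : ((Fin r × Fin r × Fin r) → ℤ) →₀ ℂ, (∀ n ∈ c.support, ∑ w, n w = 0) → c.sum (fun _ a => a) = 0 → c.sum (fun n a => ‖a‖ * Real.exp (∑ w, |(n w : ℝ)|)) ≤ B → (∀ φ : (Fin r × Fin r × Fin r) → ℝ, c₀ * ∑ w, ∑ w', (1 - Real.cos (φ w - φ w')) ≤ ((fun (φ : (Fin r × Fin r × Fin r) → ℝ) => c.sum (fun n a => a * Complex.exp (Complex.I * ((∑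 w, (n w : ℝ) * φ w : ℝ) : ℂ)))) φ).re) → ∀ (L M : ℕ) [NeZero L] [NeZero M], L₀ ≤ L → L ≤ M → let sh : (Literature.Probability.LatticeModels.TorusSite 2 L × ZMod M) → (Fin r × Fin r × Fin r) → (Literature.Probability.LatticeModels.TorusSite 2 L × ZMod M) := fun s w => (s.1 + ![((w.1 : ℕ) : ZMod L), ((w.2.1 : ℕ) : ZMod L)], s.2 + ((w.2.2 : ℕ) : ZMod M)); let F : ((Fin r × Fin r × Fin r) → ℝ) → ℂ := fun (φ : (Fin r × Fin r × Fin r) → ℝ) => c.sum (fun n a => a * Complex.exp (Complex.I * ((∑ w, (n w : ℝ) * φ w : ℝ) : ℂ))); let A : ((Literature.Probability.LatticeModels.TorusSite 2 L × ZMod M) → ℝ) → ℂ := fun θ => (K : ℂ) * ∑ s : (Literature.Probability.LatticeModels.TorusSite 2 L × ZMod M), F (fun w => θ (sh s w)); let cube : Set ((Literature.Probability.LatticeModels.TorusSite 2 L × ZMod M) → ℝ) := Set.pi Set.univ (fun _ => Set.Icc (0:ℝ) (2 * Real.pi)); let Z : ℂ := MeasureTheory.integral (MeasureTheory.volume.restrict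 cube) (fun θ => Complex.exp (-(A θ))); let O : ((Literature.Probability.LatticeModels.TorusSite 2 L × ZMod M) → ℝ) → ℝ := fun θ => ‖∑ x : Literature.Probability.LatticeModels.TorusSite 2 L, Complex.exp (Complex.I * (θ (x, 0) : ℂ))‖ ^ 2 / (L : ℝ) ^ 4; Z ≠ 0 ∧ (1/2 : ℝ) ≤ ((MeasureTheory.integral (MeasureTheory.volume.restrict cube) (fun θ => (O θ : ℂ) * Complex.exp (-(A θ)))) / Z).re

/-- item stmt-HubbardSuperconductivity-2082 · support · rank 4 · open · by planner
why it might fail: Needs (i) a convergent fermionic expansion below T~e^{-a/U} (WeakCouplingCeiling: nothing proved at delta<1/2), (ii) a fully gapped chiral d+id window at t'=0 with delta<1/2, (iii) the induced phase action INSIDE the engine class (temporal/Berry terms, exponential tails): crux 2 may need restating.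
sources: BenfattoGiulianiMastropietro2006, Salmhofer1999, FeldmanKnorrerTrubowitz2004, Mastropietro2008, RaghuKivelsonScalapino2010, BFKT2017
[crux] THE REDUCTION, typed as the implication BirComplexStableXY → BirGroundStateAverageLRO (so the
Assembly stays pure logic; compare PlaquetteBoson.PbContinuation). CONTENT (informal, the
constructive-fermion half of the dictionary): at weak coupling and a doping δ in a FULLY GAPPED
pairing window of the pure t'=0 Hubbard model — the intended instance is the chiral B1g+iB2g
(d_{x²−y²} + i d_{xy}) window around the Kohn–Luttinger B1g/B2g crossing (card
chiral-window-d-plus-id; RaghuKivelsonScalapino2010 Fig. 2 puts the crossing near n ≈ 0.6 at t'=0) —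
(1) a two-regime multiscale fermionic expansion (Fermi-liquid regime FeldmanKnorrerTrubowitz2004 /
BenfattoGiulianiMastropietro2006 down to scale Δ ~ e^{−C/U²}, then a symmetry-broken expansion
around the gapped BdG reference of crux 3, as for the long-range BCS term in Mastropietro2008 Ch.
15) integrates out the fermions in the background of a block pair-phase field θ on blocks of side ξ
= v_F/Δ and Trotter time step a = 1/Δ, with convergent, L- and β-uniform bounds BECAUSE the fermions
are gapped; (2) the resulting (2+1)D action is K·Σ_s F(θ|window) + (exponentially small tails) with
K ≥ K₀ ~ E_F/Δ, F in the class of crux 2 (U(1): -/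
@[route_item "route-HubbardSuperconductivity-BalabanIR", crux]
def BirGappedPhaseReduction : Prop :=
  BirComplexStableXY → BirGroundStateAverageLRO

/-- item stmt-HubbardSuperconductivity-14998 · support · rank 9 · closed · proved by Summit.HubbardSuperconductivity.HubbardSuperconductivity.Theorems.birRClassEvenNoZeros_proof (prover) · by planner
sources: p73645, Theorems/BalabanIRBirComplexStableXYEvenPositivity.lean, Theorems/BalabanIRBirComplexStableXYReality.lean, BerahaKahaneWeiss1975
[support] CLASS-ARTEFACT CERTIFICATE for the negative lemma on the rev-0 engine record
(BirComplexStableXY_false_of_WitnessZeroExists : WitnessZeroExists → ¬BirComplexStableXY, hold on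
stmt-2080 since 2026-08-16T06:24Z). Statement: in the RESTATED class of crux 2R — Fourier tables
with the time-reflection (Osterwalder–Schrader) Hermiticity (R) c_{n∘R} = conj c_{−n}, exactly 2R's
table-form hypothesis — for windows of temporal range r = 2 (the negative lemma's own r), EVERY real
coupling K, every L ≥ 1 and every EVEN M ≥ 1, the engine's partition function Z = ∫_{[0,2π]^Λ}
e^{−A} (same sh, F, A, cube as the engine decls) is a strictly positive real number: 0 < Re Z ∧ Im Z
= 0. No smallness, no (U1)/(N)/(A)/(C) needed. CONSEQUENCE (why it is filed): the
Beraha–Kahane–Weiss mechanism of the negative lemma — Z = 0 for an ADMISSIBLE rev-0 table with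
complex temporal stiffness 1 + iε₁ — cannot occur anywhere in 2R's scope at r = 2 (2R concludes only
at even L, M, for (R)∧(P) tables); the lemma's witness family `witness ε₁ ε₂` is (R) iff ε₁ = 0
(`witness_not_timeReflectionHermitian`, Cruxes/BirComplexStableXY/Disproof.lean, sorry-free) and at
ε₁ = 0 this certificate forbids its zeros at ev -/
@[route_item "route-HubbardSuperconductivity-BalabanIR"]
def BirRClassEvenNoZeros : Prop :=
  ∀ (c : ((Fin 2 × Fin 2 × Fin 2) → ℤ) →₀ ℂ), (∀ n : (Fin 2 × Fin 2 × Fin 2) → ℤ, c (fun w => n (w.1, w.2.1, Fin.rev w.2.2)) = (starRingEnd ℂ) (c (-n))) → ∀ (K : ℝ) (L M : ℕ) [NeZero L] [NeZero M], Even M → let sh : (Literature.Probability.LatticeModels.TorusSite 2 L × ZMod M) → (Fin 2 × Fin 2 × Fin 2) → (Literature.Probability.LatticeModels.TorusSite 2 L × ZMod M) := fun s w => (s.1 + ![((w.1 : ℕ) : ZMod L), ((w.2.1 : ℕ) : ZMod L)], s.2 + ((w.2.2 : ℕ) : ZMod M)); let F : ((Fin 2 × Fin 2 × Fin 2) → ℝ)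 → ℂ := fun (φ : (Fin 2 × Fin 2 × Fin 2) → ℝ) => c.sum (fun n a => a * Complex.exp (Complex.I * ((∑ w, (n w : ℝ) * φ w : ℝ) : ℂ))); let A : ((Literature.Probability.LatticeModels.TorusSite 2 L × ZMod M) → ℝ) → ℂ := fun θ => (K : ℂ) * ∑ s : (Literature.Probability.LatticeModels.TorusSite 2 L × ZMod M), F (fun w => θ (sh s w)); let cube : Set ((Literature.Probability.LatticeModels.TorusSite 2 L × ZMod M) → ℝ) := Set.pi Set.univ (fun _ => Set.Icc (0:ℝ) (2 * Real.pi)); let Z : ℂ := MeasureTheory.integral (MeasureTheory.volume.restrict cube) (fun θ => Complex.exp (-(A θ))); 0 < Z.re ∧ Z.im = 0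

/-- `BirRClassEvenNoZeros` holds: proved by `Summit.HubbardSuperconductivity.HubbardSuperconductivity.Theorems.birRClassEvenNoZeros_proof`. -/
theorem BirRClassEvenNoZeros_holds : BirRClassEvenNoZeros := _root_.Summit.HubbardSuperconductivity.HubbardSuperconductivity.Theorems.birRClassEvenNoZeros_proof

-- earlier Assembly (stmt-HubbardSuperconductivity-2085, replaced 2026-08-15T23:00:19Z -> stmt-HubbardSuperconductivity-13907): proved by Summit.HubbardSuperconductivity.HubbardSuperconductivity.Theorems.assembly_proof @ 6c1b84a9a692 — BirGroundStateAverageLRO → BirEveryGroundState → HubbardSuperconductivity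
/-- item stmt-HubbardSuperconductivity-13907 · assembly · rank 1 · closed · proved by Summit.HubbardSuperconductivity.HubbardSuperconductivity.Theorems.BalabanIR.assembly_frame_proof (prover) · by planner
sources: Scalapino1995, idea:HubbardSuperconductivity/HubbardSuperconductivity/complex-stable-balaban-ir-engine
[assembly] X → S with X = the thesis conjunction: `BirGroundStateAverageLRO ∧ BirEveryGroundState →
HubbardSuperconductivity` (rev 4, route-repair 2026-08-15; = the rev-0 item
stmt-HubbardSuperconductivity-2085 `BirGroundStateAverageLRO → BirEveryGroundState →
HubbardSuperconductivity` uncurried, same content). BOOKKEEPING ONLY — it is proved in this very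
file by the deciding theorem `closes` (`fun h => closes h.1 h.2`, planner Sketch.lean rc0, axioms
{propext, Classical.choice, Quot.sound}); provers attack the target and the cruxes, not this.
PROVERS / GROUNDERS / REFUTERS: do NOT close this item with a theorem whose module imports
…Theses.BalabanIR — the gate links `Assembly_holds := _root_.<thm>` by importing that module INTO
THIS FILE, and a module importing this file cycles (scratch render: 8× 'already declared' ⇒
glue.unproved, route unmaterialisable, `closes` unauditable). That is exactly what the rev-3 proof
Theorems/BalabanIRAssembly.lean (`assembly_proof`, closing stmt-2085 at 22:44Z) did; stmt-2085 is
therefore DETACHED (stays proved on the ledger) and, after this restatement, that module no longer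
elaborates (`intro hX hT` against the uncurried body) — retire it (its co -/
@[route_item "route-HubbardSuperconductivity-BalabanIR"]
def Assembly : Prop :=
  BirGroundStateAverageLRO ∧ BirEveryGroundState → _root_.HubbardSuperconductivity

/-- `Assembly` holds: proved by `Summit.HubbardSuperconductivity.HubbardSuperconductivity.Theorems.BalabanIR.assembly_frame_proof`. -/
theorem Assembly_holds : Assembly := _root_.Summit.HubbardSuperconductivity.HubbardSuperconductivity.Theorems.BalabanIR.assembly_frame_proof

-- records of items no longer active in this route (dropped / restated):
-- earlier BirSliceXYOrderRP (stmt-HubbardSuperconductivity-2084, dropped 2026-08-16T00:49:47Z): proved by Summit.HubbardSuperconductivity.HubbardSuperconductivity.Theorems.birSliceXYOrderRP_proof @ 14e6f7df1dcc — ∃ K₀ : ℝ, ∃ L₀ : ℕ, ∀ K : ℝ, K₀ ≤ K → ∀ (L M : ℕ) [NeZero L] [NeZero M], L₀ ≤ L → L ≤ M → Even L → Even M → let E : ((Literature.Probability.LatticeModels.TorusSite 2 L × ZMod M) → ℝ) → ℝ :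

/-! D-0027 §2.1 — DECIDING THEOREM (planner-authored via `route open/edit --closes-file`; by planner-rrepair-HubbardSuperconductivity-Balab-db578eb5-0 2026-08-16T07:18:24Z):
its hypotheses are this route's items and its conclusion the sub-problem Statement (glue_lint), and it elaborates with this file. -/

@[closes "route-HubbardSuperconductivity-BalabanIR"] theorem closes (h2R : BirComplexStableXYR) (h3 : BirBdGPhaseCoercivity) (h4R : BirGappedPhaseReductionR)
    (hT : BirEveryGroundState) : _root_.HubbardSuperconductivity := by
  obtain ⟨δ, hδ, U₁, U₂, c, hU₁, hU₁₂, hc, h⟩ := h4R h2R h3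
  obtain ⟨U, hU, hLRO⟩ := hT δ U₁ U₂ c hδ hU₁ hU₁₂ hc h
  show Literature.Hubbard.DWaveSuperconductivityHubbard
  exact ⟨U, lt_trans hU₁ hU.1, δ, hδ, hLRO⟩

end Summit.HubbardSuperconductivity.HubbardSuperconductivity.Theses.BalabanIR
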